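import Summits.QuantumFields.YangMills.Theorems.BalabanLadderIRDisintegrationTV
import Mathlib.Probability.Kernel.RadonNikodym
import HarnessLib

/-!
# Disintegration of total variation — an explicit Hahn set for a pair of kernels, MEASURABILITY of the fibre `tv`,
# and the inequality under `CountableOrCountablyGenerated X Y`

Add-on to `Theorems/BalabanLadderIRDisintegrationTV.lean` (★osasm-p1 g8, p502096: `disintegrationTV_of_countablyGenerated`,
selection through a countable measure-dense algebra).  Count-neutral helper for crux `stmt-QuantumFields-19354`
(`BalabanLadder.IR`; card `walls-inherit-bulk` WB0, owner READINGS R37 (d) / R46); no stub claimed, no skeleton touched.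

## What is added

* `hahnSet κ κ'` — for finite kernels `κ, κ' : X → Y` with `X` countable OR `Y` countably generated
  (`MeasurableSpace.CountableOrCountablyGenerated X Y`, the hypothesis of Mathlib's kernel Radon–Nikodym theory), the
  JOINTLY MEASURABLE set `{f > 1/2} ⊆ X × Y`, `f = Kernel.rnDerivAux κ (κ + κ')` (so `κ = (κ+κ')·f⁺`,
  `κ' = (κ+κ')·(1−f)⁺`); every slice is a Hahn set of `κ x − κ' x` in test-function form
  (`integral_sub_integral_le_slice`: `∫ g d(κ x) − ∫ g d(κ' x) ≤ κ x(H_x) − κ' x(H_x)` for measurable `g : Y → [0,1]`).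
* `tv_apply_eq` — `tv (κ x) (κ' x) = κ x (H_x) − κ' x (H_x)`; hence **`measurable_tv_apply`: `x ↦ tv (κ x) (κ' x)` is
  measurable** (so events `{x | t < tv (κ x) (κ' x)}` are honest measurable events — the `WallsInheritBulk`-type
  statements of the card need this) and `integral_sub_integral_le_tv` (`∫ g dμ − ∫ g dν ≤ tv μ ν`, `g ∈ [0,1]`).
* `disintegrationTV_of_countableOrCountablyGenerated : DisintegrationTV X Y` — the tree theorem's hypothesis
  `[CountablyGenerated Y]` relaxed to `[CountableOrCountablyGenerated X Y]` (strictly stronger: countable `X`, any `Y`),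
  by a selection-free proof: `E_π tv(κ,κ') = (π⊗κ)(H) − ∫ κ' x(H_x) dπ = [(π⊗κ)(H) − (π'⊗κ')(H)] +
  [∫ (1 − κ' x(H_x)) dπ − ∫ (1 − κ' x(H_x)) dπ'] ≤ tv(π⊗κ, π'⊗κ') + tv(π, π')`, the last step by the Hahn set of the pair
  `(π, π')` seen as constant kernels from `Unit`.

(Without any countability hypothesis `DisintegrationTV X Y` is false — cocountable counterexample in the Defs module.)
Everything here is proved (no `sorry`, no new axioms).  HONEST FRAMING: measure-theoretic bookkeeping; nothing here
bears on `IR` itself; conditional chain untouched; not a gap, not Clay.  Ref: Kallenberg, Random Measures (2017)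
Thm. 1.28 (kernel densities).
-/

set_option autoImplicit false

noncomputable section

open MeasureTheory ProbabilityTheory
open scoped ENNReal NNReal

namespace Summit.QuantumFields.YangMills.Cruxes.IR.CertIdeate2g5

/-! ## §1 An explicit, jointly measurable Hahn set for a pair of finite kernels -/

section Hahn

variable {α γ : Type*} [MeasurableSpace α] [MeasurableSpace γ] [MeasurableSpace.CountableOrCountablyGenerated α γ]
  (κ κ' : Kernel α γ)

/-- The Hahn set of the pair `(κ, κ')`: where the density of `κ` w.r.t. `κ + κ'` exceeds `1/2`. -/
def hahnSet : Set (α × γ) := {p : α × γ | (1 / 2 : ℝ) < Kernel.rnDerivAux κ (κ + κ') p.1 p.2}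

/-- The Hahn set is measurable (joint measurability of `Kernel.rnDerivAux`). -/
theorem measurableSet_hahnSet : MeasurableSet (hahnSet κ κ') :=
  measurableSet_lt measurable_const (Kernel.measurable_rnDerivAux κ (κ + κ'))

/-- Slices of the Hahn set are measurable. -/
theorem measurableSet_hahnSet_slice (a : α) : MeasurableSet (Prod.mk a ⁻¹' hahnSet κ κ') :=
  measurable_prodMk_left (measurableSet_hahnSet κ κ')

/-- The density `f⁺ = (rnDerivAux κ (κ+κ') a ·)⁺` of `κ a` against `(κ + κ') a`, as an `ℝ≥0`-valued function. -/
def dens (a : α) (x : γ) : ℝ≥0 := (Kernel.rnDerivAux κ (κ + κ') a x).toNNReal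

/-- The density `(1 − f)⁺` of `κ' a` against `(κ + κ') a`. -/
def dens' (a : α) (x : γ) : ℝ≥0 := (1 - Kernel.rnDerivAux κ (κ + κ') a x).toNNReal

/-- `dens` is measurable. -/
theorem measurable_dens (a : α) : Measurable (dens κ κ' a) :=
  (Kernel.measurable_rnDerivAux_right κ (κ + κ') a).real_toNNReal

/-- `dens'` is measurable. -/
theorem measurable_dens' (a : α) : Measurable (dens' κ κ' a) :=
  (measurable_const.sub (Kernel.measurable_rnDerivAux_right κ (κ + κ') a)).real_toNNReal

/-- Pointwise sign of the Hahn set: `(f⁺ − (1−f)⁺) · (g − 1_H) ≤ 0` for `0 ≤ g ≤ 1`. -/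
theorem dens_sub_mul_sub_indicator_nonpos (a : α) {g : γ → ℝ} (h01 : ∀ x, 0 ≤ g x ∧ g x ≤ 1) (x : γ) :
    ((dens κ κ' a x : ℝ) - dens' κ κ' a x) * (g x - (Prod.mk a ⁻¹' hahnSet κ κ').indicator 1 x) ≤ 0 := by
  have hg := h01 x
  simp only [dens, dens', Real.coe_toNNReal']
  by_cases hx : x ∈ Prod.mk a ⁻¹' hahnSet κ κ'
  · rw [Set.indicator_of_mem hx, Pi.one_apply]
    have hf : (1 / 2 : ℝ) < Kernel.rnDerivAux κ (κ + κ') a x := hx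
    have h1 : max (1 - Kernel.rnDerivAux κ (κ + κ') a x) 0 ≤ max (Kernel.rnDerivAux κ (κ + κ') a x) 0 :=
      max_le_max (by linarith) le_rfl
    nlinarith
  · rw [Set.indicator_of_notMem hx, sub_zero]
    have hf : ¬ (1 / 2 : ℝ) < Kernel.rnDerivAux κ (κ + κ') a x := hx
    have h1 : max (Kernel.rnDerivAux κ (κ + κ') a x) 0 ≤ max (1 - Kernel.rnDerivAux κ (κ + κ') a x) 0 :=
      max_le_max (by linarith) le_rfl
    nlinarith

variable [IsFiniteKernel κ] [IsFiniteKernel κ']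

/-- `κ a = (κ + κ') a · f⁺`. -/
theorem apply_eq_withDensity (a : α) : κ a = ((κ + κ') a).withDensity fun x => (dens κ κ' a x : ℝ≥0∞) := by
  have h := Kernel.withDensity_rnDerivAux κ κ'
  have hm : Measurable (Function.uncurry fun (a : α) (x : γ) =>
      ((Kernel.rnDerivAux κ (κ + κ') a x).toNNReal : ℝ≥0∞)) :=
    (Kernel.measurable_rnDerivAux κ (κ + κ')).real_toNNReal.coe_nnreal_ennreal
  conv_lhs => rw [← h]
  rw [Kernel.withDensity_apply _ hm]
  rfl

/-- `κ' a = (κ + κ') a · (1 − f)⁺`. -/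
theorem apply_eq_withDensity' (a : α) : κ' a = ((κ + κ') a).withDensity fun x => (dens' κ κ' a x : ℝ≥0∞) := by
  have h := Kernel.withDensity_one_sub_rnDerivAux κ κ'
  have hm : Measurable (Function.uncurry fun (a : α) (x : γ) =>
      ((1 - Kernel.rnDerivAux κ (κ + κ') a x).toNNReal : ℝ≥0∞)) :=
    (measurable_const.sub (Kernel.measurable_rnDerivAux κ (κ + κ'))).real_toNNReal.coe_nnreal_ennreal
  conv_lhs => rw [← h]
  rw [Kernel.withDensity_apply _ hm]
  rfl

/-- Integration against `κ a` / `κ' a` through the densities. -/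
theorem integral_eq_integral_dens (a : α) (g : γ → ℝ) :
    ∫ x, g x ∂(κ a) = ∫ x, (dens κ κ' a x : ℝ) * g x ∂((κ + κ') a) := by
  rw [apply_eq_withDensity κ κ' a, integral_withDensity_eq_integral_smul (measurable_dens κ κ' a)]
  simp only [NNReal.smul_def, smul_eq_mul]

/-- Integration against `κ' a` through the density. -/
theorem integral_eq_integral_dens' (a : α) (g : γ → ℝ) :
    ∫ x, g x ∂(κ' a) = ∫ x, (dens' κ κ' a x : ℝ) * g x ∂((κ + κ') a) := by
  rw [apply_eq_withDensity' κ κ' a, integral_withDensity_eq_integral_smul (measurable_dens' κ κ' a)]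
  simp only [NNReal.smul_def, smul_eq_mul]

/-- Bounded measurable test functions are integrable against the density-weighted reference measure. -/
theorem integrable_dens_mul (a : α) {g : γ → ℝ} (hg : Measurable g) {C : ℝ} (hC : ∀ x, |g x| ≤ C) :
    Integrable (fun x => (dens κ κ' a x : ℝ) * g x) ((κ + κ') a) := by
  have h : Integrable g (κ a) :=
    Integrable.of_mem_Icc (-C) C hg.aemeasurable (ae_of_all _ fun x => abs_le.1 (hC x))
  rw [apply_eq_withDensity κ κ' a, integrable_withDensity_iff_integrable_smul (measurable_dens κ κ' a)] at h
  simpa only [NNReal.smul_def, smul_eq_mul] using h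

/-- As `integrable_dens_mul`, for `κ'`. -/
theorem integrable_dens'_mul (a : α) {g : γ → ℝ} (hg : Measurable g) {C : ℝ} (hC : ∀ x, |g x| ≤ C) :
    Integrable (fun x => (dens' κ κ' a x : ℝ) * g x) ((κ + κ') a) := by
  have h : Integrable g (κ' a) :=
    Integrable.of_mem_Icc (-C) C hg.aemeasurable (ae_of_all _ fun x => abs_le.1 (hC x))
  rw [apply_eq_withDensity' κ κ' a, integrable_withDensity_iff_integrable_smul (measurable_dens' κ κ' a)] at h
  simpa only [NNReal.smul_def, smul_eq_mul] using h

/-- **The slice `H_a` is a Hahn set for `κ a − κ' a`, test-function form**: for measurable `g : γ → [0, 1]`,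
`∫ g d(κ a) − ∫ g d(κ' a) ≤ κ a (H_a) − κ' a (H_a)`. -/
theorem integral_sub_integral_le_slice (a : α) {g : γ → ℝ} (hg : Measurable g) (h01 : ∀ x, 0 ≤ g x ∧ g x ≤ 1) :
    ∫ x, g x ∂(κ a) - ∫ x, g x ∂(κ' a) ≤
      (κ a).real (Prod.mk a ⁻¹' hahnSet κ κ') - (κ' a).real (Prod.mk a ⁻¹' hahnSet κ κ') := by
  set H : Set γ := Prod.mk a ⁻¹' hahnSet κ κ' with hH
  have hHm : MeasurableSet H := measurableSet_hahnSet_slice κ κ' a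
  have hgC : ∀ x, |g x| ≤ 1 := fun x => abs_le.2 ⟨by linarith [(h01 x).1], (h01 x).2⟩
  have hind : Measurable (H.indicator (1 : γ → ℝ)) := measurable_one.indicator hHm
  have hindC : ∀ x, |H.indicator (1 : γ → ℝ) x| ≤ 1 := fun x => by
    by_cases hx : x ∈ H <;> simp [hx]
  rw [← integral_indicator_one hHm, ← integral_indicator_one hHm, integral_eq_integral_dens κ κ' a g,
    integral_eq_integral_dens' κ κ' a g, integral_eq_integral_dens κ κ' a (H.indicator 1),
    integral_eq_integral_dens' κ κ' a (H.indicator 1)]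
  have i1 := integrable_dens_mul κ κ' a hg hgC
  have i2 := integrable_dens'_mul κ κ' a hg hgC
  have i3 := integrable_dens_mul κ κ' a hind hindC
  have i4 := integrable_dens'_mul κ κ' a hind hindC
  have key : ∫ x, ((dens κ κ' a x : ℝ) - dens' κ κ' a x) * (g x - H.indicator 1 x) ∂((κ + κ') a) ≤ 0 :=
    integral_nonpos fun x => dens_sub_mul_sub_indicator_nonpos κ κ' a h01 x
  have i12 : Integrable (fun x => (dens κ κ' a x : ℝ) * g x - (dens' κ κ' a x : ℝ) * g x) ((κ + κ') a) :=
    i1.sub i2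
  have i34 : Integrable (fun x => (dens κ κ' a x : ℝ) * H.indicator 1 x - (dens' κ κ' a x : ℝ) * H.indicator 1 x)
      ((κ + κ') a) := i3.sub i4
  have hexp : ∫ x, ((dens κ κ' a x : ℝ) - dens' κ κ' a x) * (g x - H.indicator 1 x) ∂((κ + κ') a) =
      (∫ x, (dens κ κ' a x : ℝ) * g x ∂((κ + κ') a) - ∫ x, (dens' κ κ' a x : ℝ) * g x ∂((κ + κ') a)) -
        (∫ x, (dens κ κ' a x : ℝ) * H.indicator 1 x ∂((κ + κ') a) -
          ∫ x, (dens' κ κ' a x : ℝ) * H.indicator 1 x ∂((κ + κ') a)) := by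
    rw [← integral_sub i1 i2, ← integral_sub i3 i4, ← integral_sub i12 i34]
    refine integral_congr_ae (ae_of_all _ fun x => ?_)
    ring
  linarith

/-- **The slice computes the total variation**: `tv (κ a) (κ' a) = κ a (H_a) − κ' a (H_a)`. -/
theorem tv_apply_eq (a : α) :
    tv (κ a) (κ' a) = (κ a).real (Prod.mk a ⁻¹' hahnSet κ κ') - (κ' a).real (Prod.mk a ⁻¹' hahnSet κ κ') := by
  refine le_antisymm (tv_le_of_forall_le _ _ fun s hs => ?_)
    (by simpa only [measureReal_def] using toReal_sub_le_tv _ _ (measurableSet_hahnSet_slice κ κ' a))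
  rw [← measureReal_def, ← measureReal_def, ← integral_indicator_one hs, ← integral_indicator_one hs]
  exact integral_sub_integral_le_slice κ κ' a (measurable_one.indicator hs) fun x => by
    by_cases hx : x ∈ s <;> simp [hx]

end Hahn

/-! ## §2 Test functions against `tv`, measurability of the fibre `tv`, and the disintegration inequality -/

section Main

variable {X Y : Type*} [MeasurableSpace X] [MeasurableSpace Y]

/-- **Test-function bound**: for finite measures `μ, ν` and measurable `g : X → [0,1]`, `∫ g dμ − ∫ g dν ≤ tv μ ν`
(Hahn set of the pair seen as constant kernels from `Unit`). -/
theorem integral_sub_integral_le_tv (μ ν : Measure X) [IsFiniteMeasure μ] [IsFiniteMeasure ν] {g : X → ℝ}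
    (hg : Measurable g) (h01 : ∀ x, 0 ≤ g x ∧ g x ≤ 1) : ∫ x, g x ∂μ - ∫ x, g x ∂ν ≤ tv μ ν := by
  have h := integral_sub_integral_le_slice (Kernel.const Unit μ) (Kernel.const Unit ν) () hg h01
  simp only [Kernel.const_apply] at h
  refine h.trans ?_
  simpa only [measureReal_def] using toReal_sub_le_tv μ ν
    (measurableSet_hahnSet_slice (Kernel.const Unit μ) (Kernel.const Unit ν) ())

variable [MeasurableSpace.CountableOrCountablyGenerated X Y]

/-- **The fibre `tv` is measurable**: for finite kernels `κ, κ'` (`X` countable or `Y` countably generated),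
`x ↦ tv (κ x) (κ' x)` is a measurable function (it is the difference of the slice masses of the Hahn set). -/
theorem measurable_tv_apply (κ κ' : Kernel X Y) [IsFiniteKernel κ] [IsFiniteKernel κ'] :
    Measurable fun x => tv (κ x) (κ' x) := by
  have hH : MeasurableSet (hahnSet κ κ') := measurableSet_hahnSet κ κ'
  have h : (fun x => tv (κ x) (κ' x)) =
      fun x => (κ x).real (Prod.mk x ⁻¹' hahnSet κ κ') - (κ' x).real (Prod.mk x ⁻¹' hahnSet κ κ') :=
    funext fun x => tv_apply_eq κ κ' x
  rw [h]
  exact (Kernel.measurable_kernel_prodMk_left hH).ennreal_toReal.sub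
    (Kernel.measurable_kernel_prodMk_left (κ := κ') hH).ennreal_toReal

/-- **Disintegration of total variation under `CountableOrCountablyGenerated X Y`** (countable `X` OR countably
generated `Y`): `∫⁻ x, ofReal (tv (κ x) (κ' x)) ∂π ≤ ofReal (tv (π ⊗ₘ κ) (π' ⊗ₘ κ') + tv π π')` for probability
`π, π'` and Markov `κ, κ'` — selection-free proof through the explicit Hahn set. -/
theorem lintegral_tv_le (π π' : Measure X) [IsProbabilityMeasure π] [IsProbabilityMeasure π']
    (κ κ' : Kernel X Y) [IsMarkovKernel κ] [IsMarkovKernel κ'] :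
    ∫⁻ x, ENNReal.ofReal (tv (κ x) (κ' x)) ∂π ≤ ENNReal.ofReal (tv (π ⊗ₘ κ) (π' ⊗ₘ κ') + tv π π') := by
  set H : Set (X × Y) := hahnSet κ κ' with hHdef
  have hH : MeasurableSet H := measurableSet_hahnSet κ κ'
  -- the slice masses
  set h : X → ℝ := fun x => (κ x).real (Prod.mk x ⁻¹' H) with hh
  set h' : X → ℝ := fun x => (κ' x).real (Prod.mk x ⁻¹' H) with hh'
  have hhm : Measurable h := (Kernel.measurable_kernel_prodMk_left hH).ennreal_toReal
  have hh'm : Measurable h' := (Kernel.measurable_kernel_prodMk_left (κ := κ') hH).ennreal_toReal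
  have hh01 : ∀ x, 0 ≤ h x ∧ h x ≤ 1 := fun x => ⟨measureReal_nonneg, measureReal_le_one⟩
  have hh'01 : ∀ x, 0 ≤ h' x ∧ h' x ≤ 1 := fun x => ⟨measureReal_nonneg, measureReal_le_one⟩
  have htv : ∀ x, tv (κ x) (κ' x) = h x - h' x := fun x => tv_apply_eq κ κ' x
  -- integrability
  have hint : ∀ (μ : Measure X) [IsFiniteMeasure μ] (u : X → ℝ), Measurable u → (∀ x, 0 ≤ u x ∧ u x ≤ 1) →
      Integrable u μ := fun μ _ u hu hu01 =>
    Integrable.of_mem_Icc 0 1 hu.aemeasurable (ae_of_all _ fun x => ⟨(hu01 x).1, (hu01 x).2⟩)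
  have i1 : Integrable h π := hint π h hhm hh01
  have i2 : Integrable h' π := hint π h' hh'm hh'01
  have i2' : Integrable h' π' := hint π' h' hh'm hh'01
  -- the joint laws on the Hahn set
  have hjoint : ∀ (μ : Measure X) [IsProbabilityMeasure μ] (η : Kernel X Y) [IsMarkovKernel η],
      (μ ⊗ₘ η).real H = ∫ x, (η x).real (Prod.mk x ⁻¹' H) ∂μ := by
    intro μ _ η _
    rw [measureReal_def, Measure.compProd_apply hH, ← integral_toReal
      (Kernel.measurable_kernel_prodMk_left hH).aemeasurable (ae_of_all _ fun x => measure_lt_top _ _)]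
    rfl
  -- assemble
  have i12 : Integrable (fun x => h x - h' x) π := i1.sub i2
  have hnn : 0 ≤ᵐ[π] fun x => h x - h' x := ae_of_all _ fun x => by
    have := tv_nonneg (κ x) (κ' x)
    rw [htv x] at this
    exact this
  have hlhs : ∫⁻ x, ENNReal.ofReal (tv (κ x) (κ' x)) ∂π = ENNReal.ofReal (∫ x, (h x - h' x) ∂π) := by
    simp_rw [htv]
    exact (ofReal_integral_eq_lintegral_ofReal i12 hnn).symm
  rw [hlhs]
  refine ENNReal.ofReal_le_ofReal ?_
  have e1 : ∫ x, (h x - h' x) ∂π = ((π ⊗ₘ κ).real H - (π' ⊗ₘ κ').real H) +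
      ((∫ x, (1 - h' x) ∂π) - ∫ x, (1 - h' x) ∂π') := by
    rw [integral_sub i1 i2, hjoint π κ, hjoint π' κ', integral_sub (integrable_const _) i2,
      integral_sub (integrable_const _) i2']
    simp only [integral_const, probReal_univ, smul_eq_mul, one_mul]
    ring
  rw [e1]
  refine add_le_add (by simpa only [measureReal_def] using toReal_sub_le_tv _ _ hH) ?_
  exact integral_sub_integral_le_tv π π' (measurable_const.sub hh'm) fun x =>
    ⟨by linarith [(hh'01 x).2], by linarith [(hh'01 x).1]⟩

/-- **`DisintegrationTV X Y` holds whenever `X` is countable or `Y` is countably generated** — the tree theorem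
`disintegrationTV_of_countablyGenerated` with its hypothesis relaxed to `CountableOrCountablyGenerated X Y`. -/
theorem disintegrationTV_of_countableOrCountablyGenerated : DisintegrationTV X Y :=
  fun π π' _ _ κ κ' _ _ => lintegral_tv_le π π' κ κ'

end Main

end Summit.QuantumFields.YangMills.Cruxes.IR.CertIdeate2g5

end
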